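import Summits.Ventures.PercRepro.StarGadgetGraphReachCount

/-!
# The star gadget — the events of a cell are the weights of its fact vectors (graph half, module 6)

The bot configurations are partitioned by their MODE (`modeOf`: the mark the centre attaches to);
a configuration is in mode `μ` iff all its hubs are in allowed states and the witness condition of
the mode holds (`inMode_mk_iff`).  In a cell, the indicator of «in mode `μ` and the H-event holds»
is the weight `Wfun` of the fact vector (`event_eq_Wfun`), so the sum of the event indicators over
the allowed hub configurations is the weighted count `cell_eq` computes (`cellsum_eq`).  Finally
the total weight of a configuration splits over the modes (`w_eq_sum_modes`).
-/

namespace PercRepro.StarGadgetGraph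

open MultiGraph Finset Classical

variable {cx : Bool} {p q r s : ℕ}

/-! ### Modes partition `bot` -/

/-- Under `Local`, the centre attaches to at most one mark. -/
theorem att_unique {ω : Config (E cx p q r s)} (hL : Local ω) {m m' : Fin 3} (h : Att ω m)
    (h' : Att ω m') : m = m' := by
  obtain ⟨-, hL2, hL3⟩ := hL
  rcases h with ⟨rfl, hc⟩ | ⟨h1, hx1, hm1⟩ <;> rcases h' with ⟨rfl, hc'⟩ | ⟨h2, hx2, hm2⟩
  · rfl
  · exact (hL3 hc h2 m' hx2 hm2).symm
  · exact hL3 hc' h1 m hx1 hm1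
  · exact hL2 h1 h2 m m' hx1 hx2 hm1 hm2

/-- The mode of a configuration: the mark the centre attaches to, if any. -/
def modeOf (ω : Config (E cx p q r s)) : Mode :=
  if Att ω 0 then some 0 else if Att ω 1 then some 1 else if Att ω 2 then some 2 else none

/-- `InMode μ ω` iff `ω` is `Local` and `μ` is its mode. -/
theorem inMode_iff_modeOf (μ : Mode) (ω : Config (E cx p q r s)) :
    InMode μ ω ↔ Local ω ∧ μ = modeOf ω := by
  constructor
  · rintro ⟨hL, hA⟩
    refine ⟨hL, ?_⟩
    unfold modeOf
    split_ifs with h0 h1 h2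
    · exact (hA 0).1 h0
    · exact (hA 1).1 h1
    · exact (hA 2).1 h2
    · rcases hμ : μ with _ | m
      · rfl
      · exact absurd ((hA m).2 hμ) (by fin_cases m <;> assumption)
  · rintro ⟨hL, rfl⟩
    refine ⟨hL, fun m => ?_⟩
    unfold modeOf
    constructor
    · intro hm
      split_ifs with h0 h1 h2
      · rw [att_unique hL h0 hm]
      · rw [att_unique hL h1 hm]
      · rw [att_unique hL h2 hm]
      · exact absurd hm (by fin_cases m <;> assumption)
    · intro hm
      split_ifs at hm with h0 h1 h2
      · exact Option.some.inj hm ▸ h0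
      · exact Option.some.inj hm ▸ h1
      · exact Option.some.inj hm ▸ h2

/-- The indicator of `bot ∧ P` splits over the modes. -/
theorem sum_modes_indicator (ω : Config (E cx p q r s)) (P : Prop) [Decidable P] :
    (∑ μ : Mode, if InMode μ ω ∧ P then (1 : ℤ) else 0) =
      if (starGadget cx p q r s).IsBot ω (vm 0) (vm 1) (vm 2) ∧ P then 1 else 0 := by
  simp_rw [inMode_iff_modeOf]
  rw [isBot_iff]
  by_cases hL : Local ω
  · simp only [hL, true_and]
    rw [Finset.sum_eq_single (modeOf ω)]
    · simp
    · intro μ _ hμ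
      simp [hμ]
    · intro h
      exact absurd (Finset.mem_univ _) h
  · simp [hL]

/-! ### The mode of `mk g σ` -/

/-- In mode `μ` all hubs are in allowed states. -/
theorem allowed_of_inMode {μ : Mode} {g : Fin (if cx then 1 else 0) → Bool} {σ : HubConfig p q r s}
    (h : InMode μ (mk g σ)) : allowed μ σ := by
  obtain ⟨⟨hL1, -, -⟩, hA⟩ := h
  intro hub
  refine ⟨fun m m' hm hm' => hL1 hub m m' hm hm', fun hx m hm => ?_⟩
  exact (hA m).1 (Or.inr ⟨hub, hx, hm⟩)

/-- With all hubs allowed in mode `μ`, `Local` holds iff the centre attaches to nothing but the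
mode's mark — i.e. iff the attachment facts agree with `μ`. -/
theorem local_mk_of_allowed {μ : Mode} {g : Fin (if cx then 1 else 0) → Bool}
    {σ : HubConfig p q r s} (hA : allowed μ σ) (hc : cxOpen (mk g σ) → μ = some 2) :
    Local (mk g σ) := by
  refine ⟨fun h m m' hm hm' => (hA h).1 m m' hm hm', fun h h' m m' hx hx' hm hm' => ?_,
    fun hcx h m hx hm => ?_⟩
  · have e1 := (hA h).2 hx m hm
    have e2 := (hA h').2 hx' m' hm'
    exact Option.some.inj (e1.symm.trans e2)
  · have e1 := (hA h).2 hx m hm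
    exact Option.some.inj (e1.symm.trans (hc hcx))

/-- Mode M: the witness is the edge `c – x` open, or a hub with open `x`-edge and open `c`-edge. -/
theorem inMode_some2_mk_iff {g : Fin (if cx then 1 else 0) → Bool} {σ : HubConfig p q r s}
    (hA : allowed (some 2) σ) :
    InMode (some 2) (mk g σ) ↔ cxbit g = true ∨ factOf (Wpred (some 2)) σ := by
  have key : ∀ m, Att (mk g σ) m ↔ (m = 2 ∧ cxbit g = true) ∨ (m = 2 ∧ factOf (Wpred (some 2)) σ) := by
    intro m
    unfold Att
    rw [cxOpen_mk_iff]
    constructor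
    · rintro (h | ⟨h, hx, hm⟩)
      · exact Or.inl h
      · have := (hA h).2 hx m hm
        obtain rfl := Option.some.inj this
        exact Or.inr ⟨rfl, h, hx, 2, rfl, hm⟩
    · rintro (h | ⟨rfl, h, hx, m', hm', hmo⟩)
      · exact Or.inl h
      · obtain rfl := Option.some.inj hm'
        exact Or.inr ⟨h, hx, hmo⟩
  constructor
  · rintro ⟨-, hAtt⟩
    have := (key 2).1 ((hAtt 2).2 rfl)
    rcases this with ⟨-, h⟩ | ⟨-, h⟩
    · exact Or.inl h
    · exact Or.inr h
  · intro h
    refine ⟨local_mk_of_allowed hA fun _ => rfl, fun m => ?_⟩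
    rw [key m]
    constructor
    · rintro (⟨rfl, -⟩ | ⟨rfl, -⟩) <;> rfl
    · intro hm
      obtain rfl := Option.some.inj hm
      rcases h with h | h
      · exact Or.inl ⟨rfl, h⟩
      · exact Or.inr ⟨rfl, h⟩

/-- Modes K and L: the edge `c – x` is closed (or absent) and a hub with open `x`-edge carries the
mode's mark. -/
theorem inMode_someKL_mk_iff {m₀ : Fin 3} (hm₀ : m₀ ≠ 2) {g : Fin (if cx then 1 else 0) → Bool}
    {σ : HubConfig p q r s} (hA : allowed (some m₀) σ) :
    InMode (some m₀) (mk g σ) ↔ cxbit g = false ∧ factOf (Wpred (some m₀)) σ := by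
  have key : ∀ m, Att (mk g σ) m ↔ (m = 2 ∧ cxbit g = true) ∨ (m = m₀ ∧ factOf (Wpred (some m₀)) σ) := by
    intro m
    unfold Att
    rw [cxOpen_mk_iff]
    constructor
    · rintro (h | ⟨h, hx, hm⟩)
      · exact Or.inl h
      · have := (hA h).2 hx m hm
        obtain rfl := Option.some.inj this
        exact Or.inr ⟨rfl, h, hx, m₀, rfl, hm⟩
    · rintro (h | ⟨rfl, h, hx, m', hm', hmo⟩)
      · exact Or.inl h
      · obtain rfl := Option.some.inj hm'
        exact Or.inr ⟨h, hx, hmo⟩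
  constructor
  · rintro ⟨-, hAtt⟩
    have h1 := (key m₀).1 ((hAtt m₀).2 rfl)
    have h2 : ¬ Att (mk g σ) 2 := fun h => hm₀ (Option.some.inj ((hAtt 2).1 h))
    rw [key 2] at h2
    refine ⟨?_, ?_⟩
    · cases hg : cxbit g
      · rfl
      · exact absurd (Or.inl ⟨rfl, hg⟩) h2
    · rcases h1 with ⟨h, -⟩ | ⟨-, h⟩
      · exact absurd h hm₀
      · exact h
  · rintro ⟨hg, hW⟩
    refine ⟨local_mk_of_allowed hA fun hc => ?_, fun m => ?_⟩
    · rw [cxOpen_mk_iff, hg] at hc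
      cases hc
    · rw [key m]
      constructor
      · rintro (⟨-, h⟩ | ⟨rfl, -⟩)
        · rw [hg] at h; cases h
        · rfl
      · intro hm
        obtain rfl := Option.some.inj hm
        exact Or.inr ⟨rfl, hW⟩

/-- Mode R: the edge `c – x` is closed (or absent); no hub with open `x`-edge carries a mark. -/
theorem inMode_none_mk_iff {g : Fin (if cx then 1 else 0) → Bool} {σ : HubConfig p q r s}
    (hA : allowed none σ) : InMode none (mk g σ) ↔ cxbit g = false := by
  have key : ∀ m, Att (mk g σ) m ↔ (m = 2 ∧ cxbit g = true) := by
    intro m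
    unfold Att
    rw [cxOpen_mk_iff]
    constructor
    · rintro (h | ⟨h, hx, hm⟩)
      · exact h
      · have := (hA h).2 hx m hm
        cases this
    · intro h
      exact Or.inl h
  constructor
  · rintro ⟨-, hAtt⟩
    have h2 : ¬ Att (mk g σ) 2 := fun h => by cases (hAtt 2).1 h
    rw [key 2] at h2
    cases hg : cxbit g
    · rfl
    · exact absurd ⟨rfl, hg⟩ h2
  · intro hg
    refine ⟨local_mk_of_allowed hA fun hc => ?_, fun m => ?_⟩
    · rw [cxOpen_mk_iff, hg] at hc
      cases hc
    · rw [key m]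
      constructor
      · rintro ⟨-, h⟩
        rw [hg] at h; cases h
      · intro h; cases h

/-! ### The event of a cell is the weight of the fact vector -/

/-- In a cell, «in mode `μ` and the H-event holds» is the weight `Wfun` of the fact vector of the
hub configuration: the live pairs are covered by the family (`hlive`) and the mode is the witness
condition (`hmode`). -/
theorem event_eq_Wfun {k : ℕ} (μ : Mode) (X : Option (Fin 3)) (src dst : Fin 4)
    (pairs : Fin k → Option (Fin 4 × Fin 4)) (g : Fin (if cx then 1 else 0) → Bool)
    (σ : HubConfig p q r s)
    (hlive : ∀ i j, i ≠ j → nx X μ i = true → nx X μ j = true →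
      T2 cx (cxbit g) μ i j = false → ∃ l, pairs l = some (i, j) ∨ pairs l = some (j, i))
    (hmode : InMode μ (mk g σ) ↔ (hasW pairs → factOf (Wpred μ) σ)) :
    (if InMode μ (mk g σ) ∧ (starGadget cx p q r s).HConnAvoid (mk g σ) (vm 2) (Xset (mk g σ) X)
        (cen src) (cen dst) then (1 : ℤ) else 0) =
      Wfun cx (cxbit g) μ X pairs src dst (tvec μ X pairs σ) := by
  unfold Wfun
  -- the witness condition of the fact vector is the mode
  have hw : wcond pairs (tvec μ X pairs σ) ↔ InMode μ (mk g σ) := by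
    rw [hmode]
    unfold wcond hasW tvec
    constructor
    · rintro h ⟨l, hl⟩
      have := h l hl
      rw [decide_eq_true_iff] at this
      unfold famPred at this
      rw [hl] at this
      exact this
    · intro h l hl
      rw [decide_eq_true_iff]
      unfold famPred
      rw [hl]
      exact h ⟨l, hl⟩
  by_cases hM : InMode μ (mk g σ)
  · have hβ : cxOpen (mk g σ) ↔ cxbit g = true := cxOpen_mk_iff g σ
    -- the detour facts of the live pairs are read off the fact vector
    have hd : ∀ i j, i ≠ j → nx X μ i = true → nx X μ j = true →
        T2 cx (cxbit g) μ i j = false →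
        ((∃ h, ¬ inX μ X (hubType h) (hubState (mk g σ) h) ∧
          Hf μ i (hubType h) (hubState (mk g σ) h) ∧ Hf μ j (hubType h) (hubState (mk g σ) h)) ↔
          dmat pairs (tvec μ X pairs σ) i j = true) := by
      intro i j hij hi hj hT
      simp only [hubState_mk]
      unfold dmat tvec
      rw [decide_eq_true_iff]
      constructor
      · intro hD
        obtain ⟨l, hl⟩ := hlive i j hij hi hj hT
        refine ⟨l, hl, ?_⟩
        rw [decide_eq_true_iff]
        unfold famPred factOf
        rcases hl with hl | hl <;> rw [hl]
        · obtain ⟨h, h1, h2, h3⟩ := hD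
          exact ⟨h, h1, h2, h3⟩
        · obtain ⟨h, h1, h2, h3⟩ := hD
          exact ⟨h, h1, h3, h2⟩
      · rintro ⟨l, hl, hf⟩
        rw [decide_eq_true_iff] at hf
        unfold famPred factOf at hf
        rcases hl with hl | hl <;> rw [hl] at hf
        · obtain ⟨h, h1, h2, h3⟩ := hf
          exact ⟨h, h1, h2, h3⟩
        · obtain ⟨h, h1, h2, h3⟩ := hf
          exact ⟨h, h1, h3, h2⟩
    have hR := hConnAvoid_cen_iff_reach4 hM hβ X (dmat pairs (tvec μ X pairs σ)) hd src dst
    have hw' : wcond pairs (tvec μ X pairs σ) := hw.2 hM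
    by_cases hE : reach4 (cellMat cx (cxbit g) μ X (dmat pairs (tvec μ X pairs σ))) src dst
    · rw [if_pos ⟨hM, hR.2 hE⟩, if_pos ⟨hw', hE⟩]
    · rw [if_neg (fun h => hE (hR.1 h.2)), if_neg (fun h => hE h.2)]
  · have hw' : ¬ wcond pairs (tvec μ X pairs σ) := fun h => hM (hw.1 h)
    rw [if_neg (fun h => hM h.1), if_neg (fun h => hw' h.1)]

/-- **The cell sum**: the number of allowed hub configurations in mode `μ` whose H-event holds
is the weighted count of `cell_eq`. -/
theorem cellsum_eq {k : ℕ} (μ : Mode) (X : Option (Fin 3)) (src dst : Fin 4)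
    (pairs : Fin k → Option (Fin 4 × Fin 4)) (g : Fin (if cx then 1 else 0) → Bool)
    (hlive : ∀ i j, i ≠ j → nx X μ i = true → nx X μ j = true →
      T2 cx (cxbit g) μ i j = false → ∃ l, pairs l = some (i, j) ∨ pairs l = some (j, i))
    (hmode : ∀ σ : HubConfig p q r s, allowed μ σ →
      (InMode μ (mk g σ) ↔ (hasW pairs → factOf (Wpred μ) σ))) :
    (∑ σ ∈ univ.filter (allowed μ : HubConfig p q r s → Prop),
      if InMode μ (mk g σ) ∧ (starGadget cx p q r s).HConnAvoid (mk g σ) (vm 2)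
        (Xset (mk g σ) X) (cen src) (cen dst) then (1 : ℤ) else 0) =
      ∑ σ ∈ univ.filter (allowed μ : HubConfig p q r s → Prop),
        Wfun cx (cxbit g) μ X pairs src dst (tvec μ X pairs σ) := by
  refine Finset.sum_congr rfl fun σ hσ => ?_
  rw [Finset.mem_filter] at hσ
  exact event_eq_Wfun μ X src dst pairs g σ hlive (hmode σ hσ.2)

/-- A cell that is impossible (mode `μ ≠ M` with the edge `c – x` open) contributes nothing. -/
theorem cellsum_eq_zero_of_open {μ : Mode} (hμ : μ ≠ some 2) (X : Option (Fin 3)) (src dst : Fin 4)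
    (g : Fin (if cx then 1 else 0) → Bool) (hg : cxbit g = true) :
    (∑ σ ∈ univ.filter (allowed μ : HubConfig p q r s → Prop),
      if InMode μ (mk g σ) ∧ (starGadget cx p q r s).HConnAvoid (mk g σ) (vm 2)
        (Xset (mk g σ) X) (cen src) (cen dst) then (1 : ℤ) else 0) = 0 := by
  refine Finset.sum_eq_zero fun σ _ => ?_
  have hM : ¬ InMode μ (mk g σ) := by
    rintro ⟨-, hAtt⟩
    have : Att (mk g σ) 2 := Or.inl ⟨rfl, (cxOpen_mk_iff g σ).2 hg⟩
    exact hμ ((hAtt 2).1 this)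
  simp [hM]

/-! ### The total weight splits over the modes -/

/-- The three H-events of the (★)-slack, on `mk g σ`. -/
def ev (X : Option (Fin 3)) (src dst : Fin 4) (ω : Config (E cx p q r s)) : Prop :=
  (starGadget cx p q r s).HConnAvoid ω (vm 2) (Xset ω X) (cen src) (cen dst)

/-- The weight of a configuration: `[bot ∧ o1] + [bot ∧ o2] − [bot ∧ bad]`. -/
noncomputable def w (ω : Config (E cx p q r s)) : ℤ :=
  (if (starGadget cx p q r s).IsBot ω (vm 0) (vm 1) (vm 2) ∧ ev (some 1) 2 0 ω then 1 else 0) +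
    (if (starGadget cx p q r s).IsBot ω (vm 0) (vm 1) (vm 2) ∧ ev (some 0) 2 1 ω then 1 else 0) -
      (if (starGadget cx p q r s).IsBot ω (vm 0) (vm 1) (vm 2) ∧ ev none 0 1 ω then 1 else 0)

/-- The weight of a mode: the same with `InMode μ` in place of `bot`. -/
noncomputable def wmode (μ : Mode) (ω : Config (E cx p q r s)) : ℤ :=
  (if InMode μ ω ∧ ev (some 1) 2 0 ω then 1 else 0) +
    (if InMode μ ω ∧ ev (some 0) 2 1 ω then 1 else 0) -
      (if InMode μ ω ∧ ev none 0 1 ω then 1 else 0)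

/-- The weight is the sum of the mode weights. -/
theorem w_eq_sum_wmode (ω : Config (E cx p q r s)) : w ω = ∑ μ : Mode, wmode μ ω := by
  unfold w wmode
  rw [Finset.sum_sub_distrib, Finset.sum_add_distrib]
  rw [sum_modes_indicator, sum_modes_indicator, sum_modes_indicator]

/-- The sum of a mode weight over all hub configurations is its sum over the allowed ones. -/
theorem sum_wmode_eq_filter (μ : Mode) (g : Fin (if cx then 1 else 0) → Bool) :
    (∑ σ : HubConfig p q r s, wmode μ (mk g σ)) =
      ∑ σ ∈ univ.filter (allowed μ : HubConfig p q r s → Prop), wmode μ (mk g σ) := by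
  rw [Finset.sum_filter]
  refine Finset.sum_congr rfl fun σ _ => ?_
  by_cases hA : allowed μ σ
  · rw [if_pos hA]
  · have hM : ¬ InMode μ (mk g σ) := fun h => hA (allowed_of_inMode h)
    rw [if_neg hA]
    unfold wmode
    rw [if_neg (fun h => hM h.1), if_neg (fun h => hM h.1), if_neg (fun h => hM h.1)]
    norm_num

/-- The sum of the weight over the hub configurations splits over the modes, each restricted to
its allowed configurations. -/
theorem sum_w_mk (g : Fin (if cx then 1 else 0) → Bool) :
    ∑ σ : HubConfig p q r s, w (mk g σ) =
      ∑ μ : Mode, ∑ σ ∈ univ.filter (allowed μ : HubConfig p q r s → Prop), wmode μ (mk g σ) := by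
  simp_rw [w_eq_sum_wmode]
  rw [Finset.sum_comm]
  exact Finset.sum_congr rfl fun μ _ => sum_wmode_eq_filter μ g

end PercRepro.StarGadgetGraph
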